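import Mathlib.Analysis.Complex.Basic
import Mathlib.Topology.Algebra.Group.Basic
import Mathlib.Algebra.Group.Conj
import HarnessLib

/-!
# Langlands–Shelstad (1987), §4 «Some Properties of Δ» — the numbered statements as named predicates

R. P. Langlands, D. Shelstad, *On the definition of transfer factors*, Math. Ann. **278** (1987) 219–271
[LanglandsShelstad1987].  PAGE PINS «(p. N)» are the printed Math. Ann. 278 pages, read on the GDZ scan (page texts
`HOME/lit/lit3/g0/texts/LanglandsShelstad1987-GDZ/p0219.txt … p0272.txt` of the HCML cell); the text was READ on the authors'
re-typeset reissue `paper:doi-10-1007-bf01458070` (58 pp., own pagination 1–58, item numbering identical), §4 = typescript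
pp. 34–40 = Math. Ann. pp. 249–254:
(4.1) Invariance — Lemma 4.1.A, Corollary 4.1.B, Lemma 4.1.C; (4.2) The Local Hypothesis — the quotient `Δ_{G/G*}`, the
number `λ_H`, Lemma 4.2.A, Corollary 4.2.B; (4.3) Extension to all `G`-regular elements — the limit definition and the
extended matching identity; (4.4) Passage to central extensions — Lemma 4.4.A and the `z`-extension transformation law.
Squad TN (HCML «GO 500», SPLIT-v1 row TN-t03); topic `NumberTheory/Automorphic/LanglandsShelstad1987`, namespace
`Literature.NumberTheory.Automorphic.LanglandsShelstad1987.Properties`.  STATEMENTS ONLY: no theorem, no `sorry`, no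
axiom, no instance, no notation.

## Standing setting of §3–§4 (p. 240, (3.1); p. 224, (1.2); pp. 225–226, (1.3))
`F` a local field of characteristic zero, `G` connected reductive over `F` with quasi-split inner form `ψ : G → G*`,
endoscopic data `(H, ℋ, s, ξ)` with `ℋ = ᴸH` until (4.4); «Throughout Sect. 3 `F` will be local and `γ_H`, `γ̄_H` will be
strongly `G`-regular elements in `H(F)` which are images of the elements `γ_G`, `γ̄_G` in `G(F)`» (p. 240).  (3.7) (p. 248):
«We now fix the pair `γ̄_H`, `γ̄_G` and specify `Δ(γ̄_H, γ̄_G)` arbitrarily.  Then we define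
`Δ(γ_H, γ_G) = Δ(γ̄_H, γ̄_G) Δ(γ_H, γ_G; γ̄_H, γ̄_G)`», the second factor being the canonical RELATIVE factor
`Δ_I Δ_II Δ_{III₂} Δ_IV (γ) / (same at γ̄) · Δ_{III₁}(γ_H, γ_G; γ̄_H, γ̄_G)`; «if no strongly regular element in `G(F)` has an
image in `H(F)` we set `Δ ≡ 0`».

## How §4 is typed here, and why as PREDICATES
The factor `Δ` of (3.7) is built from `a`-data, `χ`-data, admissible embeddings and Tate–Nakayama pairings (§§2–3); none
of these is in Mathlib or in the tree today (the §3 file `TransferFactorDefinition` and the shared `Defs` of this directory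
are being typed concurrently by TN-t02 ∕ TN-t01).  A CLOSED proposition «Lemma 4.1.A» would have to quantify over a
construction the tree does not have; quantified instead over ARBITRARY functions it would be false.  Therefore every
numbered item of §4 is a `def … : Prop` PREDICATE on EXPLICIT data — the tree's discipline for printed statements about
objects Lean cannot yet construct (`Literature.NumberTheory.Automorphic.Liu2021.Prop413AsPrinted`: «a consumer takes
`(h : X P)` for ITS OWN `P`; `∀ P, X P` is not claimed»).  The data, in print's words:
* `A` — the group `H(F)`; `B` — the group `G(F)`; `Bs` — the group `G*(F)` (§4.2); `Z` — `Z(F)`, `Z` the centre of `G`,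
  with its homomorphisms `ιH : Z →* A`, `ιG : Z →* B` («The center of `G` is canonically embedded as a central subgroup
  of `H`», p. 252); `A₁`, `B₁`, `Z₁`, `p : B₁ →* B` — `H₁(F)`, `G₁(F)`, `Z₁(F)` and `G₁(F) → G(F)` of a `z`-extension (p. 253).
* `sregH : A → Prop` — «strongly `G`-regular» (p. 225); `sregG : B → Prop` — «strongly regular» («elements whose centralizer
  is a torus», p. 225); `gregH : A → Prop` — «`G`-regular» (p. 225); `img : A → B → Prop` — «`γ_H` is an image of `γ_G`»
  (p. 226; for `G*`: `imgs : A → Bs → Prop`); `stH : A → A → Prop` — stable conjugacy in `H(F)`; conjugacy in `G(F)` is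
  Mathlib's `IsConj`.
* `Δ : A → B → ℂ` — the factor `Δ(γ_H, γ_G)` of (3.7) (for `G*`: `Δs : A → Bs → ℂ`); `Δrel : A → B → A → B → ℂ` — the
  relative factor `Δ(γ_H, γ_G; γ̄_H, γ̄_G)` of (3.7); `lamH : B → Bs → B → Bs → ℂ` — the number
  `λ_H(γ_G, γ_{G*}; γ̄_G, γ̄_{G*})` of (4.2), which print DEFINES as the Tate–Nakayama pairing `⟨inv(…), s_U⟩` of (3.4) for the
  unique admissible embeddings with `γ_H ↦ γ_{G*}`, `γ̄_H ↦ γ̄_{G*}` (p. 250) — a bare function here, so Lemma 4.2.A is the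
  predicate «the double quotient equals THAT function»; instantiated with print's `λ_H` it is print's lemma.
* §4.3: `A` topological (`H(F)`), `TH : Subgroup A` — `T_H(F)`, `T_H` the maximal torus `Cent(γ⁰_H, H)⁰` (p. 226, p. 252);
  `φ : ι → (TH →* B)` — for representatives `g_1, …, g_n` of `𝔇(T_G) = T_G(F) \ 𝔄(T_G) / G(F)` the maps
  `γ_H ↦ g_i⁻¹ γ_G g_i`, `γ_G` the image of `γ_H` under the fixed `T_H → T_G` (p. 252: these land in `G(F)` although
  `g_i ∈ G(F̄)`); `ψ : κ → (TH →* A)` — likewise `γ_H ↦ h_j⁻¹ γ_H h_j` for representatives `h_j` of `𝔇(T_H)`;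
  `ΦH : A → ℂ`, `Φ : B → ℂ` — the orbital integrals `γ_H ↦ Φ(γ_H, f^H)`, `γ ↦ Φ(γ, f)` of a FIXED pair `f^H`, `f` (pp. 226–227),
  as functions of the element (the tree's named orbital integrals live in `Literature.NumberTheory.Automorphic.LocalOrbitalIntegral`
  and `Literature.NumberTheory.Rogawski1990.LocalTransfer`; they are not imported — §4.3 only needs their values).
Where print DEFINES an object from these data the definition is REAL (a `def` with a body): `innerFormQuotient`
(`Δ_{G/G*}`, p. 250), `limitFactor` (the limit of (4.3), p. 252, via Mathlib's `limUnder` along `𝓝[strongly G-regular] γ⁰_H` —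
junk when the limit fails, which `Par43LimitExists` says it does not), `zExtensionFactor` (`Δ(γ_{H₁}, γ_G)`, p. 254).
For every predicate: instantiated with print's objects it is exactly the printed statement (hypotheses listed item by
item below); `∀ data, …` is NOT claimed and is false for junk data.  When `…/LanglandsShelstad1987/Defs.lean` and
`…/TransferFactorDefinition.lean` land, their fields ∕ definitions are what a consumer plugs into these parameters; nothing
here has to change.

## Item ↦ declaration (paper order)
| print | Math. Ann. page | declaration |
|---|---|---|
| Lemma 4.1.A (cocycle identity of the relative factor) | p. 249 | `Lemma41ACocycle` |
| Corollary 4.1.B (i), (ii) | p. 249 | `Cor41BiSelf`, `Cor41BiiAbsOfRel` |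
| Lemma 4.1.C (class invariance) | p. 249 | `Lemma41CClassInvariance` |
| (4.2) «γ_H is also strongly `G*`-regular … image of a stable class in `G*(F)`» | p. 250 | `Par42ImageInQuasiSplitForm` |
| (4.2) «both `Δ(γ_H, γ_G)` and `Δ(γ_H, γ_{G*})` are defined and nonzero» | p. 250 | `Par42NonzeroOnImages` |
| (4.2) definition of `Δ_{G/G*}(γ_H, γ_G, γ_{G*})` | p. 250 | `innerFormQuotient` |
| Lemma 4.2.A | p. 250 | `Lemma42AQuotientLaw` |
| Corollary 4.2.B (the Local Hypothesis of [L2, Chap. VI]) | p. 251 | `Cor42BLocalHypothesis` |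
| (4.3) definition of `Δ(γ⁰_H, γ^{0,i}_G)` as a limit | p. 252 | `limitFactor` |
| (4.3) «the right side [is] well-defined» (+ density of strongly `G`-regular elements) | p. 252 | `Par43LimitExists` |
| (4.3) the extended matching identity `Φ^{st}(γ⁰_H, f^H) = Σ_i Δ(γ⁰_H, γ^{0,i}_G) Φ(γ^{0,i}_G, f)` | p. 252 | `Par43ExtendedMatching` |
| (4.4) «if `γ_H` is an image of `γ_G` then `zγ_H` is an image of `zγ_G`» | p. 252 | `Par44ImageCentral` |
| Lemma 4.4.A (central character `λ_G`) | p. 252 | `Lemma44ACentralCharacter` |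
| (4.4) definition of `Δ(γ_{H₁}, γ_G)` for a `z`-extension | p. 254 | `zExtensionFactor` |
| (4.4) «`Δ(zγ_{H₁}, γ_G) = λ(z) Δ(γ_{H₁}, γ_G)`, `z ∈ Z₁(F)`» | p. 254 | `Par44ZExtensionLaw` |

DEDUP.  `lean search` finds no abstract transfer-factor ∕ endoscopy vocabulary in Mathlib; in the tree the 17 + 17 tags
`[cite: LanglandsShelstad1987, Lemma 4.1.A]` ∕ `[…, §4.2]` are PROVENANCE tags on explicit `U(3)`-model theorems under
`Literature/NumberTheory/Rogawski1990/` (e.g. `ArchExplicitTransferFactorLocallyConstant`, `FinExplicitTransferFactorMuTwist`,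
`LocalTransferAtOneMuTwist`) — specialisations, not the abstract statements, which are new.  See also ★
`Literature.NumberTheory.Rogawski1990.TransferFactorData` (`LocalTransfer.lean`): its fields `eq_zero_of_not_rel`,
`conj_left`, `conj_right` are the (1.4)(i)(ii) ∕ Lemma 4.1.C bookkeeping in the `U(3)` currency; `Lemma41CClassInvariance`
below is the abstract sentence with STABLE conjugacy on the `H`-side, as printed.

NOT typed here: the proofs; Theorem 3.7.A and the terms `Δ_I, …, Δ_IV` (§3, file `TransferFactorDefinition`); the closing
remarks of (4.4) (only the equivalence class of `(H, ℋ, s, ξ)` matters; `ψ ↦ Int x ∘ ψ` has no effect; `ξ₁ ↦ b ⊗ ξ₁`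
multiplies `λ`, `λ₁` by `λ₀`) and the parenthetical remark of (4.2) that `λ_H` is a class function of its four arguments
(p. 250), recorded in this sentence only; §5 (file `RegularUnipotent`), §6 (file `GlobalProductFormula`).

## References
* [LanglandsShelstad1987] R. P. Langlands, D. Shelstad, *On the definition of transfer factors*, Math. Ann. 278 (1987)
  219–271: §4 = pp. 249–254, with (1.2)–(1.4) pp. 224–227, (3.1) p. 240, (3.4) pp. 245–246, (3.7) p. 248 (pins from the
  GDZ scan texts); read on the typescript reissue `paper:doi-10-1007-bf01458070`, §4 = typescript pp. 34–40 (materialised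
  pages p0034–p0040), (1.2)–(1.4) = typescript pp. 6–10, (3.1) p. 25, (3.4) pp. 30–31, (3.7) p. 34.
* [L2] R. P. Langlands, *Les débuts d'une formule des traces stable*, Publ. Math. Univ. Paris VII 13 (1983), Chap. VI
  (the Local Hypothesis) — cited by print at Cor. 4.2.B; not used here beyond the name.
-/

open Filter Topology

namespace Literature.NumberTheory.Automorphic.LanglandsShelstad1987.Properties

/-! ## (4.1) Invariance (p. 249) -/

section Invariance

variable {A B : Type*} [Group A] [Group B]

/-- **[LanglandsShelstad1987, Lemma 4.1.A (p. 249)]**, for the relative factor `Δrel` = `Δ(γ_H, γ_G; γ̄_H, γ̄_G)` of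
(3.7) on pairs (strongly `G`-regular `γ_H`, `γ_G`) with `γ_H` an image of `γ_G` (standing hypotheses of (3.1), p. 240):
«`Δ(γ¹_H, γ¹_G; γ²_H, γ²_G) Δ(γ²_H, γ²_G; γ³_H, γ³_G) = Δ(γ¹_H, γ¹_G; γ³_H, γ³_G)`.»
Typed: for all three pairs `(aᵢ, bᵢ)` with `sregH aᵢ` and `img aᵢ bᵢ`, `Δrel a₁ b₁ a₂ b₂ * Δrel a₂ b₂ a₃ b₃ = Δrel a₁ b₁ a₃ b₃`.
A predicate on (`sregH`, `img`, `Δrel`); print proves it for the factor of (3.7). [cite: LanglandsShelstad1987, Lemma 4.1.A (p. 249)] -/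
def Lemma41ACocycle (sregH : A → Prop) (img : A → B → Prop) (Δrel : A → B → A → B → ℂ) : Prop :=
  ∀ ⦃a₁ : A⦄ ⦃b₁ : B⦄ ⦃a₂ : A⦄ ⦃b₂ : B⦄ ⦃a₃ : A⦄ ⦃b₃ : B⦄,
    sregH a₁ → img a₁ b₁ → sregH a₂ → img a₂ b₂ → sregH a₃ → img a₃ b₃ →
      Δrel a₁ b₁ a₂ b₂ * Δrel a₂ b₂ a₃ b₃ = Δrel a₁ b₁ a₃ b₃

/-- **[LanglandsShelstad1987, Corollary 4.1.B (i) (p. 249)]**: «`Δ(γ_H, γ_G; γ_H, γ_G) = 1`» (for strongly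
`G`-regular `γ_H` an image of `γ_G`, (3.1)).  Typed: `sregH a → img a b → Δrel a b a b = 1`.
[cite: LanglandsShelstad1987, Corollary 4.1.B (i) (p. 249)] -/
def Cor41BiSelf (sregH : A → Prop) (img : A → B → Prop) (Δrel : A → B → A → B → ℂ) : Prop :=
  ∀ ⦃a : A⦄ ⦃b : B⦄, sregH a → img a b → Δrel a b a b = 1

/-- **[LanglandsShelstad1987, Corollary 4.1.B (ii) (p. 249)]**: «`Δ(γ′_H, γ′_G) = Δ(γ_H, γ_G) Δ(γ′_H, γ′_G; γ_H, γ_G)`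
if `γ_H`, `γ′_H` are images of `γ_G`, `γ′_G` respectively» — `Δ` the factor of (3.7), `Δrel` the relative factor.
Typed: `sregH a → img a b → sregH a′ → img a′ b′ → Δ a′ b′ = Δ a b * Δrel a′ b′ a b`.
[cite: LanglandsShelstad1987, Corollary 4.1.B (ii) (p. 249)] -/
def Cor41BiiAbsOfRel (sregH : A → Prop) (img : A → B → Prop) (Δ : A → B → ℂ) (Δrel : A → B → A → B → ℂ) : Prop :=
  ∀ ⦃a : A⦄ ⦃b : B⦄ ⦃a' : A⦄ ⦃b' : B⦄, sregH a → img a b → sregH a' → img a' b' → Δ a' b' = Δ a b * Δrel a' b' a b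

/-- **[LanglandsShelstad1987, Lemma 4.1.C (p. 249)]**: «`Δ(γ_H, γ_G)` depends only on the stable conjugacy class of
`γ_H` in `H(F)` and the conjugacy class of `γ_G` in `G(F)`.»  `Δ` is defined on (strongly `G`-regular) × (strongly regular)
pairs (p. 227, p. 248), whence the guards `sregH a`, `sregG b`; `stH` = stable conjugacy in `H(F)` (for strongly regular
elements «the same as conjugacy under `H(F̄)`», p. 226), conjugacy in `G(F)` = Mathlib's `IsConj`.  Typed as the two
sentences: `stH a a′ → Δ a b = Δ a′ b` and `IsConj b b′ → Δ a b = Δ a b′`.  See also ★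
`Literature.NumberTheory.Rogawski1990.TransferFactorData.conj_left ∕ conj_right` (the `U(3)`-currency bookkeeping, ordinary
conjugacy on both sides). [cite: LanglandsShelstad1987, Lemma 4.1.C (p. 249)] -/
def Lemma41CClassInvariance (sregH : A → Prop) (sregG : B → Prop) (stH : A → A → Prop) (Δ : A → B → ℂ) : Prop :=
  (∀ ⦃a a' : A⦄ ⦃b : B⦄, sregH a → sregG b → stH a a' → Δ a b = Δ a' b) ∧
    ∀ ⦃a : A⦄ ⦃b b' : B⦄, sregH a → sregG b → IsConj b b' → Δ a b = Δ a b'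

end Invariance

/-! ## (4.2) The Local Hypothesis (pp. 250–251) -/

section LocalHypothesis

variable {A B Bs : Type*} [Group A] [Group B] [Group Bs]

/-- **[LanglandsShelstad1987, (4.2) (p. 250)]**, first paragraph: «The endoscopic data `(H, ℋ, s, ξ)` serve both `G`
and `G*`.  Suppose that strongly `G`-regular `γ_H ∈ H(F)` is an image of `γ_G ∈ G(F)`.  Then `γ_H` is also strongly
`G*`-regular.  By Steinberg's Theorem [K1], `γ_H` is the image of a stable conjugacy class of elements in `G*(F)`.»
Typed (the existence sentence): `sregH a → img a b → ∃ bs, imgs a bs`, with `imgs` = «is an image of» for `(G*, H)`.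
[cite: LanglandsShelstad1987, §4.2 (p. 250)] -/
def Par42ImageInQuasiSplitForm (sregH : A → Prop) (img : A → B → Prop) (imgs : A → Bs → Prop) : Prop :=
  ∀ ⦃a : A⦄ ⦃b : B⦄, sregH a → img a b → ∃ bs : Bs, imgs a bs

/-- **[LanglandsShelstad1987, (4.2) (p. 250)]**: «Then both `Δ(γ_H, γ_G)` and `Δ(γ_H, γ_{G*})` are defined and
nonzero» — for strongly `G`-regular `γ_H` an image of `γ_G` (the terms `Δ_I, …, Δ_IV` of §3 do not vanish; cf. p. 227
«It is best to demand that `Δ(γ_H, γ)` be nonzero if `γ_H` is an image of `γ`»).  Typed for one factor `Δ` and its image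
relation: `sregH a → img a b → Δ a b ≠ 0` (use it for `(G, Δ, img)` and for `(G*, Δs, imgs)`).
[cite: LanglandsShelstad1987, §4.2 (p. 250)] -/
def Par42NonzeroOnImages (sregH : A → Prop) (img : A → B → Prop) (Δ : A → B → ℂ) : Prop :=
  ∀ ⦃a : A⦄ ⦃b : B⦄, sregH a → img a b → Δ a b ≠ 0

/-- **[LanglandsShelstad1987, (4.2) (p. 250)]**, definition: «Set `Δ_{G/G*}(γ_H, γ_G, γ_{G*}) = Δ(γ_H, γ_G) / Δ(γ_H, γ_{G*})`»
— `Δ` the factor for `(G, H)`, `Δs` the factor for `(G*, H)` (same endoscopic data, same auxiliary choices), `γ_{G*}` in the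
stable class of `G*(F)` whose image is `γ_H`.  REAL definition (Mathlib division on `ℂ`, junk `x / 0 = 0` off print's domain,
where `Par42NonzeroOnImages` excludes it). [cite: LanglandsShelstad1987, §4.2 (p. 250)] -/
noncomputable def innerFormQuotient (Δ : A → B → ℂ) (Δs : A → Bs → ℂ) (a : A) (b : B) (bs : Bs) : ℂ :=
  Δ a b / Δs a bs

/-- **[LanglandsShelstad1987, Lemma 4.2.A (p. 250)]**:
«`Δ_{G/G*}(γ_H, γ_G, γ_{G*}) / Δ_{G/G*}(γ̄_H, γ̄_G, γ̄_{G*}) = λ_H(γ_G, γ_{G*}; γ̄_G, γ̄_{G*})`», where `γ_H` (resp. `γ̄_H`) is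
strongly `G`-regular and an image of `γ_G` and of `γ_{G*}` (resp. of `γ̄_G` and of `γ̄_{G*}`) (p. 250).  Typed with
`innerFormQuotient` for `Δ_{G/G*}` and the bare function `lamH` for `λ_H`:
hypotheses `sregH a, img a b, imgs a bs, sregH ā, img ā b̄, imgs ā b̄s`, conclusion
`innerFormQuotient Δ Δs a b bs / innerFormQuotient Δ Δs ā b̄ b̄s = lamH b bs b̄ b̄s`.
[cite: LanglandsShelstad1987, Lemma 4.2.A (p. 250)] -/
def Lemma42AQuotientLaw (sregH : A → Prop) (img : A → B → Prop) (imgs : A → Bs → Prop) (Δ : A → B → ℂ)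
    (Δs : A → Bs → ℂ) (lamH : B → Bs → B → Bs → ℂ) : Prop :=
  ∀ ⦃a : A⦄ ⦃b : B⦄ ⦃bs : Bs⦄ ⦃a' : A⦄ ⦃b' : B⦄ ⦃bs' : Bs⦄,
    sregH a → img a b → imgs a bs → sregH a' → img a' b' → imgs a' bs' →
      innerFormQuotient Δ Δs a b bs / innerFormQuotient Δ Δs a' b' bs' = lamH b bs b' bs'

/-- **[LanglandsShelstad1987, Corollary 4.2.B (p. 251)]**:
«`Δ(γ_H, γ_G) / Δ(γ̄_H, γ̄_G) = λ_H(γ_G, γ_{G*}; γ̄_G, γ̄_{G*}) · Δ(γ_H, γ_{G*}) / Δ(γ̄_H, γ̄_{G*})`.  This asserts that the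
factors `Δ` satisfy the Local Hypothesis of [L2, Chap. VI].»  Same data and hypotheses as `Lemma42AQuotientLaw`;
conclusion `Δ a b / Δ ā b̄ = lamH b bs b̄ b̄s * (Δs a bs / Δs ā b̄s)`.
[cite: LanglandsShelstad1987, Corollary 4.2.B (p. 251)] -/
def Cor42BLocalHypothesis (sregH : A → Prop) (img : A → B → Prop) (imgs : A → Bs → Prop) (Δ : A → B → ℂ)
    (Δs : A → Bs → ℂ) (lamH : B → Bs → B → Bs → ℂ) : Prop :=
  ∀ ⦃a : A⦄ ⦃b : B⦄ ⦃bs : Bs⦄ ⦃a' : A⦄ ⦃b' : B⦄ ⦃bs' : Bs⦄,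
    sregH a → img a b → imgs a bs → sregH a' → img a' b' → imgs a' bs' →
      Δ a b / Δ a' b' = lamH b bs b' bs' * (Δs a bs / Δs a' bs')

end LocalHypothesis

/-! ## (4.3) Extension to all `G`-regular elements (p. 252) -/

section Extension

variable {A B : Type*} [Group A] [Group B] [TopologicalSpace A]

/-- **[LanglandsShelstad1987, (4.3) (p. 252)]**, the definition: for `G`-regular `γ⁰_H ∈ T_H(F)` that is an image of
`γ⁰_G ∈ T_G(F)`, an admissible embedding `T_H → T` and `Int x ∘ ψ : T → T_G` over `F` with `γ⁰_H ↦ γ⁰_G`, and representatives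
`g_1, …, g_n` of `𝔇(T_G)`: «We define `Δ(γ⁰_H, γ^{0,i}_G) = lim_{γ_H → γ⁰_H} Δ(γ_H, g_i⁻¹ γ_G g_i)`», the limit over strongly
`G`-regular `γ_H ∈ T_H(F)`, `γ_G` the image of `γ_H` under `T_H → T_G`.  Here `TH : Subgroup A` is `T_H(F) ≤ H(F)` with the
subspace topology, `φi : TH →* B` is `γ_H ↦ g_i⁻¹ γ_G g_i` (values in `G(F)`, p. 252), and the limit is Mathlib's `limUnder`
along `𝓝[{strongly G-regular}] γ⁰_H` — a junk value when that limit does not exist, which `Par43LimitExists` (print: «an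
examination of the terms in `Δ` shows the right side to be well-defined») rules out.
[cite: LanglandsShelstad1987, §4.3 (p. 252)] -/
noncomputable def limitFactor (Δ : A → B → ℂ) (sregH : A → Prop) (TH : Subgroup A) (φi : TH →* B) (a₀ : TH) : ℂ :=
  limUnder (𝓝[{t : TH | sregH (t : A)}] a₀) fun t : TH => Δ (t : A) (φi t)

/-- **[LanglandsShelstad1987, (4.3) (p. 252)]**, well-definedness of the limit: for every `G`-regular `γ⁰_H ∈ T_H(F)`
(print: image of `γ⁰_G ∈ T_G(F)`, which is built into the maps `φ i`), «We may find a sequence `{γ_H}` of strongly `G`-regular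
elements in `T_H(F)` such that `{γ_H} → γ⁰_H` … as an examination of the terms in `Δ` shows the right side to be
well-defined.»  Typed: `γ⁰_H` lies in the closure of the strongly `G`-regular elements of `T_H(F)`, and for every `i` the
function `γ_H ↦ Δ(γ_H, g_i⁻¹ γ_G g_i)` has a limit along `𝓝[{strongly G-regular}] γ⁰_H` (data as in `limitFactor`,
`φ : ι → (TH →* B)` the family over the representatives of `𝔇(T_G)`, `gregH` = «`G`-regular»).
[cite: LanglandsShelstad1987, §4.3 (p. 252)] -/
def Par43LimitExists {ι : Type*} (Δ : A → B → ℂ) (sregH gregH : A → Prop) (TH : Subgroup A) (φ : ι → (TH →* B)) :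
    Prop :=
  ∀ ⦃a₀ : TH⦄, gregH (a₀ : A) →
    a₀ ∈ closure {t : TH | sregH (t : A)} ∧
      ∀ i, ∃ c : ℂ, Tendsto (fun t : TH => Δ (t : A) (φ i t)) (𝓝[{t : TH | sregH (t : A)}] a₀) (𝓝 c)

/-- **[LanglandsShelstad1987, (4.3) (p. 252)]**, the extended matching identity: «Then if `f`, `f^H` have
`Δ`-matching orbital integrals we have `Φ^{st}(γ⁰_H, f^H) = Σ_{i=1}^{n} Δ(γ⁰_H, γ^{0,i}_G) Φ(γ^{0,i}_G, f)`, where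
`Φ(γ^{0,i}_G, f)` is as specified in (1.3) and `Φ^{st}(γ⁰_H, f^H) = Σ_{j=1}^{m} Φ(γ^{0,j}_H, f^H)`, with
`γ^{0,j}_H = h_j⁻¹ γ⁰_H h_j` and `{h_j}` representatives for `𝔇(T_H)`.  Thus on either side a conjugacy class may contribute
several terms.»  Data: `ΦH : A → ℂ` and `Φ : B → ℂ` the orbital integrals `Φ(·, f^H)`, `Φ(·, f)` of the FIXED pair as
functions of the element; `ψ : κ → (TH →* A)` the maps `γ_H ↦ h_j⁻¹ γ_H h_j`; `φ : ι → (TH →* B)` as in `limitFactor`.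
Typed, at every `G`-regular `γ⁰_H ∈ T_H(F)`: IF the `Δ`-matching identity holds at the strongly `G`-regular elements of
`T_H(F)` in the form `Σ_j Φ(h_j⁻¹ γ_H h_j, f^H) = Σ_i Δ(γ_H, g_i⁻¹ γ_G g_i) Φ(g_i⁻¹ γ_G g_i, f)` (print's (1.4) matching read on
`T_H(F)`: for strongly regular `γ_H`, `γ_G` the `h_j⁻¹ γ_H h_j`, `g_i⁻¹ γ_G g_i` represent the conjugacy classes in the two
stable classes, p. 252, and `Δ(γ_H, ·)` vanishes off the latter, p. 227) THEN
`Σ_j ΦH (ψ j γ⁰_H) = Σ_i limitFactor … (φ i) γ⁰_H * Φ (φ i γ⁰_H)`. [cite: LanglandsShelstad1987, §4.3 (p. 252)] -/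
def Par43ExtendedMatching {ι κ : Type*} [Fintype ι] [Fintype κ] (Δ : A → B → ℂ) (sregH gregH : A → Prop)
    (TH : Subgroup A) (ψ : κ → (TH →* A)) (φ : ι → (TH →* B)) (ΦH : A → ℂ) (Φ : B → ℂ) : Prop :=
  ∀ ⦃a₀ : TH⦄, gregH (a₀ : A) →
    (∀ t : TH, sregH (t : A) → ∑ j, ΦH (ψ j t) = ∑ i, Δ (t : A) (φ i t) * Φ (φ i t)) →
      ∑ j, ΦH (ψ j a₀) = ∑ i, limitFactor Δ sregH TH (φ i) a₀ * Φ (φ i a₀)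

end Extension

/-! ## (4.4) Passage to central extensions (pp. 252–254) -/

section Central

variable {A B Z : Type*} [Group A] [Group B] [CommGroup Z]

/-- **[LanglandsShelstad1987, (4.4) (p. 252)]**: «The center of `G` is canonically embedded as a central subgroup of
`H`.  If `γ_H` is an image of `γ_G` then `zγ_H` is an image of `zγ_G`, `z ∈ Z(F)`.»  Data: `ιH : Z →* A`, `ιG : Z →* B`
the two embeddings of `Z(F)`.  Typed: `img a b → img (ιH z * a) (ιG z * b)`.
[cite: LanglandsShelstad1987, §4.4 (p. 252)] -/
def Par44ImageCentral (img : A → B → Prop) (ιH : Z →* A) (ιG : Z →* B) : Prop :=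
  ∀ (z : Z) ⦃a : A⦄ ⦃b : B⦄, img a b → img (ιH z * a) (ιG z * b)

variable [TopologicalSpace Z]

/-- **[LanglandsShelstad1987, Lemma 4.4.A (p. 252)]** (still assuming `ℋ = ᴸH`): «There is a character `λ_G` on
`Z(F)` such that `Δ(zγ_H, zγ_G) = λ_G(z) Δ(γ_H, γ_G)`, `z ∈ Z(F)`, for all `γ_H`, `γ_G`.»  Print adds: «The proof will be
included in another paper.  There is one case which it is useful to treat here.  Proof for `z` in the identity component
`Z⁰` of `Z`: …» (pp. 252–253, complete) — so the instance of this predicate with `Z := Z⁰(F)` is proved in the paper, the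
instance `Z := Z(F)` is the lemma as stated.  Data: `ιH : Z →* A`, `ιG : Z →* B` the central embeddings of (the chosen
subgroup of) `Z(F)`, a topological group; «character» = continuous homomorphism `Z(F) → ℂ^×` (typed `Z →* ℂˣ` with
`z ↦ (λ z : ℂ)` continuous); «for all `γ_H`, `γ_G`» = on the domain of `Δ` (strongly `G`-regular × strongly regular, p. 227),
guards `sregH a`, `sregG b`. [cite: LanglandsShelstad1987, Lemma 4.4.A (p. 252)] -/
def Lemma44ACentralCharacter (sregH : A → Prop) (sregG : B → Prop) (Δ : A → B → ℂ) (ιH : Z →* A) (ιG : Z →* B) :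
    Prop :=
  ∃ lam : Z →* ℂˣ, Continuous (fun z => (lam z : ℂ)) ∧
    ∀ (z : Z) ⦃a : A⦄ ⦃b : B⦄, sregH a → sregG b → Δ (ιH z * a) (ιG z * b) = (lam z : ℂ) * Δ a b

end Central

section ZExtension

variable {A₁ B₁ B Z₁ : Type*} [Group A₁] [Group B₁] [Group B] [CommGroup Z₁]

/-- **[LanglandsShelstad1987, (4.4) (p. 254)]**, the definition for a `z`-extension `1 → Z₁ → G₁ → G → 1` with
endoscopic data `(H₁, ᴸH₁, s, ξ₁)` for `G₁` (p. 253): «We need consider only elements `γ_{H₁}` whose image in `H(F)` is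
strongly `G`-regular.  Then `γ_{H₁}` is an image of `γ_G ∈ G(F)` if it is an image of some `γ_{G₁}` in the preimage of `γ_G`
in `G₁(F)`.  The element `γ_{G₁}` is uniquely determined. … The factor `Δ(γ_{H₁}, γ_{G₁})` has been defined.  We set
`Δ(γ_{H₁}, γ_G) = Δ(γ_{H₁}, γ_{G₁})` if `γ_{H₁}` is an image of `γ_{G₁}` and `γ_G` is the image of `γ_{G₁}` under
`G₁(F) → G(F)`, or `Δ(γ_{H₁}, γ_G) = 0` if `γ_{H₁}` is not an image of `γ_G`.»  Data: `Δ₁ : A₁ → B₁ → ℂ` the factor for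
`(G₁, H₁)`, `img₁` its image relation, `p : B₁ →* B` the map `G₁(F) → G(F)`.  REAL definition (a classical `dite` on the
existence of such a `γ_{G₁}`, chosen by `Classical.choose`; print's uniqueness makes the choice immaterial).
[cite: LanglandsShelstad1987, §4.4 (p. 254)] -/
noncomputable def zExtensionFactor (Δ₁ : A₁ → B₁ → ℂ) (img₁ : A₁ → B₁ → Prop) (p : B₁ →* B) (a₁ : A₁) (b : B) : ℂ :=
  @dite ℂ (∃ b₁ : B₁, p b₁ = b ∧ img₁ a₁ b₁) (Classical.dec _) (fun h => Δ₁ a₁ (Classical.choose h)) fun _ => 0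

/-- **[LanglandsShelstad1987, (4.4) (p. 254)]**, the transformation law (printed and proved there): «Because of the
transformation rule for `f^{H₁}` we must have `Δ(zγ_{H₁}, γ_G) = λ(z) Δ(γ_{H₁}, γ_G)`, `z ∈ Z₁(F)`», `λ` the character of
`Z₁(F)` with parameter `W_F → ᴸG₁ → ᴸZ₁` (first arrow `ξ₁|_{W_F}`, p. 253); print derives it from
`Δ(zγ_{H₁}, zγ_{G₁}) = λ₁(z) Δ(γ_{H₁}, γ_{G₁})` and «`λ₁` coincides with `λ` on `Z₁(F)`» (p. 254).  Data: as in
`zExtensionFactor`, plus `ι₁ : Z₁ →* A₁` the central embedding `Z₁(F) → H₁(F)`, `lam : Z₁ → ℂ` the character `λ`,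
`sreg₁ : A₁ → Prop` = «image in `H(F)` strongly `G`-regular», `sregG : B → Prop` = strongly regular in `G(F)`.
Typed: `sreg₁ a₁ → sregG b → zExtensionFactor Δ₁ img₁ p (ι₁ z * a₁) b = lam z * zExtensionFactor Δ₁ img₁ p a₁ b`.
[cite: LanglandsShelstad1987, §4.4 (p. 254)] -/
def Par44ZExtensionLaw (sreg₁ : A₁ → Prop) (sregG : B → Prop) (Δ₁ : A₁ → B₁ → ℂ) (img₁ : A₁ → B₁ → Prop)
    (p : B₁ →* B) (ι₁ : Z₁ →* A₁) (lam : Z₁ → ℂ) : Prop :=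
  ∀ (z : Z₁) ⦃a₁ : A₁⦄ ⦃b : B⦄, sreg₁ a₁ → sregG b →
    zExtensionFactor Δ₁ img₁ p (ι₁ z * a₁) b = lam z * zExtensionFactor Δ₁ img₁ p a₁ b

end ZExtension

end Literature.NumberTheory.Automorphic.LanglandsShelstad1987.Properties
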